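import Mathlib
import Summits.Ventures.PercRepro2.PointSplitBHK

/-!
# The point-split form (PS1) decomposed along the two `v`-classes: (PS1) = (S2) + BHK
(blind cell PercRepro2, night-3 g24, 2026-08-29; `proofs/NIGHT3-CERT.md` §33)

Fix avoided sets `X, Y` (`Z = X ∩ Y`, `U = X ∪ Y`), a split point `v` and cluster functionals
`F, G`.  Write `π = P(v ∈ C_s; s ↮ U)`, `π' = P(v ∉ C_s; s ↮ U)`, `x = E[FG·1_{vH}; Z]`,
`x' = E[FG·1_{v̄H}; Z]`, `a = E[F·1_{vH}; X]`, `a' = E[F·1_{v̄H}; X]`, `c = E[G·1_{vH}; Y]`,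
`c' = E[G·1_{v̄H}; Y]`.  The second point-split form of `PointSplitBHK.lean` is
`M(1_{vH}, 1) = x(2π + π') + x'π − 2ac − ac' − a'c`, and the exact identity

  `π·π'·M(1_{vH}, 1) = (2π + π')·π'·(πx − ac) + (π'a − πa')(π'c − πc') + π²·(π'x' − a'c')`

(`mul_mixedForm_one_eq_s2Form_add`) splits it into the **division-free (S2) form**
`s2Form := (2π + π')π'(πx − ac) + (π'a − πa')(π'c − πc')` and `π²` times the BHK form with the
avoided sets `X ∪ {v}, Y ∪ {v}` (`wExpect_indicator_compl_eq_insert`: the `v̄`-class weight IS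
avoidance of `v`).  In conditional language (`X = Y = ∅`, `A = {v ∈ C_s}`): `(PS1)/P(A) =
(1 + π)·Cov_A(F, G) + (1 − π)·Cov_{Aᶜ}(F, G) + (1 − π)·(E_A F − E_{Aᶜ} F)(E_A G − E_{Aᶜ} G)`, where
`Cov_{Aᶜ} ≥ 0` is BHK (van den Berg–Häggström–Kahn) for the cluster law conditioned on `s ↮ v`,
and (S2) is the part beyond BHK: `(1 + π)·Cov_A + (1 − π)·ΔF·ΔG ≥ 0`.

* **`PointSplitS2`** — the CANDIDATE `s2Form ≥ 0` (NOT claimed proved; exact census night-3 g24: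
  0 failures / 561 random instances, with up-set indicator functionals included; `Cov_A < 0`
  occurs but is tiny relative to `ΔF·ΔG`).
* **`mixedForm_one_nonneg_of_pointSplitS2`**: (S2) ⟹ (PS1) = `PointSplitBHKOne` — the BHK term
  is nonnegative by `bhkForm_one_nonneg`, and the degenerate classes (`π = 0` or `π' = 0`) are
  handled by `wExpect_eq_zero_of_mass_zero` (then `M = 0`, resp. `M = 2·S_1 ≥ 0`).

So (S2) is a candidate of record strictly stronger than (PS1), isolating exactly what the point
split asks beyond the BHK toolbox.  Own work; standard axioms.
-/

namespace Summit.Ventures.PercRepro2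

open UnionCluster

namespace CovForm

namespace PointSplit

variable {V : Type*} {E : Type*} [Fintype E] [DecidableEq E]
  {R : Type*} [Field R] [LinearOrder R] [IsStrictOrderedRing R]

/-! ## The `v̄`-class weight is avoidance of `v` -/

omit [LinearOrder R] [IsStrictOrderedRing R] in
/-- `E[F·1_{v ∉ C_s}; s ↮ X] = E[F; s ↮ X ∪ {v}]`. -/
lemma wExpect_indicator_compl_eq_insert [DecidableEq V] (p : E → R) (ends : E → Sym2 V) (s v : V)
    (X : Finset V) (F : Set V → R) :
    wExpect p ends s X F (((connEvent ends s v)ᶜ).indicator 1) =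
      wExpect p ends s (insert v X) F (fun _ => 1) := by
  unfold wExpect
  refine congrArg _ (funext fun ω => ?_)
  by_cases hX : ω ∈ avoidAll ends s X
  · by_cases hv : ω ∈ connEvent ends s v
    · have h1 : ω ∉ (connEvent ends s v)ᶜ := fun h => h hv
      have h2 : ω ∉ avoidAll ends s (insert v X) :=
        fun h => h v (Finset.mem_insert_self v X) hv
      rw [Set.indicator_of_notMem h1, Set.indicator_of_notMem h2]
      simp
    · have h1 : ω ∈ (connEvent ends s v)ᶜ := hv
      have h2 : ω ∈ avoidAll ends s (insert v X) := by
        intro x hx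
        rcases Finset.mem_insert.1 hx with rfl | hx'
        · exact hv
        · exact hX x hx'
      rw [Set.indicator_of_mem h1, Set.indicator_of_mem hX, Set.indicator_of_mem h2]
      simp
  · have h2 : ω ∉ avoidAll ends s (insert v X) :=
      fun h => hX fun x hx => h x (Finset.mem_insert_of_mem hx)
    rw [Set.indicator_of_notMem hX, Set.indicator_of_notMem h2]
    simp

omit [LinearOrder R] [IsStrictOrderedRing R] in
/-- The point split of a weighted expectation: `E[F; X] = E[F·1_{vH}; X] + E[F·1_{v̄H}; X]`. -/
lemma wExpect_one_split (p : E → R) (ends : E → Sym2 V) (s v : V) (X : Finset V)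
    (F : Set V → R) :
    wExpect p ends s X F (fun _ => 1) =
      wExpect p ends s X F ((connEvent ends s v).indicator 1) +
        wExpect p ends s X F (((connEvent ends s v)ᶜ).indicator 1) := by
  rw [← indicator_conn_add_compl (R := R) ends s v, wExpect_add]

/-- If the weighted mass `E[w; X]` vanishes (nonnegative `w`, admissible `p`), so does
`E[F·w; X]` for every `F`. -/
lemma wExpect_eq_zero_of_mass_zero {p : E → R} (hp : IsProbVec p) (ends : E → Sym2 V) (s : V)
    (X : Finset V) (F : Set V → R) {w : Config E → R} (hw : ∀ ω, 0 ≤ w ω)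
    (h : wExpect p ends s X (fun _ => 1) w = 0) : wExpect p ends s X F w = 0 := by
  unfold wExpect expect at h ⊢
  have hz : ∀ ω ∈ (Finset.univ : Finset (Config E)),
      weight p ω * ((fun _ : Set V => (1 : R)) (cluster ends ω s) * w ω *
        (avoidAll ends s X).indicator 1 ω) = 0 := by
    rw [Finset.sum_eq_zero_iff_of_nonneg] at h
    · exact h
    · intro ω _
      exact mul_nonneg (weight_nonneg hp ω) (mul_nonneg (mul_nonneg zero_le_one (hw ω))
        (Set.indicator_apply_nonneg fun _ => zero_le_one))
  refine Finset.sum_eq_zero fun ω _ => ?_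
  have h0 := hz ω (Finset.mem_univ ω)
  simp only [one_mul] at h0
  calc weight p ω * (F (cluster ends ω s) * w ω * (avoidAll ends s X).indicator 1 ω)
      = F (cluster ends ω s) * (weight p ω * (w ω * (avoidAll ends s X).indicator 1 ω)) := by
        ring
    _ = 0 := by rw [h0, mul_zero]

/-! ## The division-free (S2) form -/

/-- The **division-free (S2) form** `(2π + π')·π'·(πx − ac) + (π'a − πa')(π'c − πc')` with
`π = E[1_{vH}; X ∪ Y]`, `π' = E[1_{v̄H}; X ∪ Y]`, `x = E[FG·1_{vH}; X ∩ Y]`, `a = E[F·1_{vH}; X]`,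
`a' = E[F·1_{v̄H}; X]`, `c = E[G·1_{vH}; Y]`, `c' = E[G·1_{v̄H}; Y]`: in conditional language it is
`π²π'·[(2π + π')·Cov_{vH}(F, G) + π'·(E_{vH}F − E_{v̄H}F)(E_{vH}G − E_{v̄H}G)]`. -/
noncomputable def s2Form [DecidableEq V] (p : E → R) (ends : E → Sym2 V) (s : V) (X Y : Finset V)
    (F G : Set V → R) (v : V) : R :=
  (2 * wExpect p ends s (X ∪ Y) (fun _ => 1) ((connEvent ends s v).indicator 1) +
      wExpect p ends s (X ∪ Y) (fun _ => 1) (((connEvent ends s v)ᶜ).indicator 1)) *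
    wExpect p ends s (X ∪ Y) (fun _ => 1) (((connEvent ends s v)ᶜ).indicator 1) *
    (wExpect p ends s (X ∪ Y) (fun _ => 1) ((connEvent ends s v).indicator 1) *
        wExpect p ends s (X ∩ Y) (fun W => F W * G W) ((connEvent ends s v).indicator 1) -
      wExpect p ends s X F ((connEvent ends s v).indicator 1) *
        wExpect p ends s Y G ((connEvent ends s v).indicator 1)) +
  (wExpect p ends s (X ∪ Y) (fun _ => 1) (((connEvent ends s v)ᶜ).indicator 1) *
        wExpect p ends s X F ((connEvent ends s v).indicator 1) -
      wExpect p ends s (X ∪ Y) (fun _ => 1) ((connEvent ends s v).indicator 1) *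
        wExpect p ends s X F (((connEvent ends s v)ᶜ).indicator 1)) *
    (wExpect p ends s (X ∪ Y) (fun _ => 1) (((connEvent ends s v)ᶜ).indicator 1) *
        wExpect p ends s Y G ((connEvent ends s v).indicator 1) -
      wExpect p ends s (X ∪ Y) (fun _ => 1) ((connEvent ends s v).indicator 1) *
        wExpect p ends s Y G (((connEvent ends s v)ᶜ).indicator 1))

omit [LinearOrder R] [IsStrictOrderedRing R] in
/-- **The decomposition (PS1) = (S2) + BHK**:
`π·π'·M(1_{vH}, 1) = s2Form + π²·S_{X ∪ {v}, Y ∪ {v}}(F, G)`. -/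
theorem mul_mixedForm_one_eq_s2Form_add [DecidableEq V] (p : E → R) (ends : E → Sym2 V) (s v : V)
    (X Y : Finset V) (F G : Set V → R) :
    wExpect p ends s (X ∪ Y) (fun _ => 1) ((connEvent ends s v).indicator 1) *
        wExpect p ends s (X ∪ Y) (fun _ => 1) (((connEvent ends s v)ᶜ).indicator 1) *
        mixedFormW p ends s X Y F G ((connEvent ends s v).indicator 1) (fun _ => 1) =
      s2Form p ends s X Y F G v +
        (wExpect p ends s (X ∪ Y) (fun _ => 1) ((connEvent ends s v).indicator 1)) ^ 2 *
          bhkFormW p ends s (insert v X) (insert v Y) F G (fun _ => 1) := by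
  have hI : insert v X ∩ insert v Y = insert v (X ∩ Y) := by
    ext x
    simp only [Finset.mem_inter, Finset.mem_insert]
    tauto
  have hU : insert v X ∪ insert v Y = insert v (X ∪ Y) := by
    ext x
    simp only [Finset.mem_union, Finset.mem_insert]
    tauto
  unfold mixedFormW bhkFormW s2Form
  rw [hI, hU, ← wExpect_indicator_compl_eq_insert p ends s v X F,
    ← wExpect_indicator_compl_eq_insert p ends s v Y G,
    ← wExpect_indicator_compl_eq_insert p ends s v (X ∩ Y) (fun W => F W * G W),
    ← wExpect_indicator_compl_eq_insert p ends s v (X ∪ Y) (fun _ => 1),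
    wExpect_one_split p ends s v (X ∩ Y) (fun W => F W * G W),
    wExpect_one_split p ends s v (X ∪ Y) (fun _ => 1), wExpect_one_split p ends s v X F,
    wExpect_one_split p ends s v Y G]
  ring

/-- **(S2), a CANDIDATE (NOT claimed proved)**: the division-free form `s2Form ≥ 0` for every
product law, every avoided set `X` (the same on both sides), every split point `v` and all
nonnegative monotone cluster functionals `F, G`.  By `mul_mixedForm_one_eq_s2Form_add` it is (PS1)
minus a BHK term, hence STRONGER than `PointSplitBHKOne` at `X = Y`.  Census (night-3 g24, exact
rationals, `X = ∅`): 0 failures / 561 random instances (447 with up-set indicator functionals). -/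
def PointSplitS2 [DecidableEq V] (ends : E → Sym2 V) (s : V) : Prop :=
  ∀ (p : E → R), IsProbVec p → ∀ (X : Finset V) (v : V) (F G : Set V → R),
    Monotone F → Monotone G → (∀ S, 0 ≤ F S) → (∀ S, 0 ≤ G S) → 0 ≤ s2Form p ends s X X F G v

/-- The non-degenerate case: if both `v`-classes have positive mass on `{s ↮ X ∪ Y}` and
`s2Form ≥ 0`, then `M(1_{vH}, 1) ≥ 0`. -/
theorem mixedForm_one_nonneg_of_s2Form [Fintype V] [DecidableEq V] (p : E → R) (hp : IsProbVec p)
    (ends : E → Sym2 V) (s v : V) (X Y : Finset V) {F G : Set V → R} (hF : Monotone F)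
    (hG : Monotone G) (hF0 : ∀ S, 0 ≤ F S) (hG0 : ∀ S, 0 ≤ G S)
    (hπ : 0 < wExpect p ends s (X ∪ Y) (fun _ => 1) ((connEvent ends s v).indicator 1))
    (hπ' : 0 < wExpect p ends s (X ∪ Y) (fun _ => 1) (((connEvent ends s v)ᶜ).indicator 1))
    (hS : 0 ≤ s2Form p ends s X Y F G v) :
    0 ≤ mixedFormW p ends s X Y F G ((connEvent ends s v).indicator 1) (fun _ => 1) := by
  have hB := bhkForm_one_nonneg p hp ends s (insert v X) (insert v Y) hF hG hF0 hG0
  have key := mul_mixedForm_one_eq_s2Form_add p ends s v X Y F G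
  have hpos : 0 < wExpect p ends s (X ∪ Y) (fun _ => 1) ((connEvent ends s v).indicator 1) *
      wExpect p ends s (X ∪ Y) (fun _ => 1) (((connEvent ends s v)ᶜ).indicator 1) :=
    mul_pos hπ hπ'
  have h0 : 0 ≤ wExpect p ends s (X ∪ Y) (fun _ => 1) ((connEvent ends s v).indicator 1) *
      wExpect p ends s (X ∪ Y) (fun _ => 1) (((connEvent ends s v)ᶜ).indicator 1) *
      mixedFormW p ends s X Y F G ((connEvent ends s v).indicator 1) (fun _ => 1) := by
    rw [key]
    exact add_nonneg hS (mul_nonneg (sq_nonneg _) hB)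
  exact (mul_nonneg_iff_of_pos_left hpos).1 h0

omit [LinearOrder R] [IsStrictOrderedRing R] in
/-- The second point-split form at `X = Y` in the eight class masses. -/
lemma mixedForm_one_diag_eq [DecidableEq V] (p : E → R) (ends : E → Sym2 V) (s v : V)
    (X : Finset V) (F G : Set V → R) :
    mixedFormW p ends s X X F G ((connEvent ends s v).indicator 1) (fun _ => 1) =
      wExpect p ends s X (fun W => F W * G W) ((connEvent ends s v).indicator 1) *
          (wExpect p ends s X (fun _ => 1) ((connEvent ends s v).indicator 1) +
            wExpect p ends s X (fun _ => 1) (((connEvent ends s v)ᶜ).indicator 1)) +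
        (wExpect p ends s X (fun W => F W * G W) ((connEvent ends s v).indicator 1) +
            wExpect p ends s X (fun W => F W * G W) (((connEvent ends s v)ᶜ).indicator 1)) *
          wExpect p ends s X (fun _ => 1) ((connEvent ends s v).indicator 1) -
        wExpect p ends s X F ((connEvent ends s v).indicator 1) *
          (wExpect p ends s X G ((connEvent ends s v).indicator 1) +
            wExpect p ends s X G (((connEvent ends s v)ᶜ).indicator 1)) -
        (wExpect p ends s X F ((connEvent ends s v).indicator 1) +
            wExpect p ends s X F (((connEvent ends s v)ᶜ).indicator 1)) *
          wExpect p ends s X G ((connEvent ends s v).indicator 1) := by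
  unfold mixedFormW
  rw [Finset.inter_self, Finset.union_self, wExpect_one_split p ends s v X (fun W => F W * G W),
    wExpect_one_split p ends s v X (fun _ => 1), wExpect_one_split p ends s v X F,
    wExpect_one_split p ends s v X G]

/-- **(S2) ⟹ (PS1) at `X = Y`**: the candidate `PointSplitS2` gives `M(1_{vH}, 1) ≥ 0` for every
product law, avoided set `X` (on both sides), split point `v` and nonnegative monotone `F, G` —
the degenerate classes included (`π = 0`: `M = 0`; `π' = 0`: `M = 2·S_1 ≥ 0`). -/
theorem mixedForm_one_nonneg_of_pointSplitS2 [Fintype V] [DecidableEq V] (ends : E → Sym2 V)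
    (s : V) (hS2 : PointSplitS2 (R := R) ends s) (p : E → R) (hp : IsProbVec p) (X : Finset V)
    (v : V) {F G : Set V → R} (hF : Monotone F) (hG : Monotone G) (hF0 : ∀ S, 0 ≤ F S)
    (hG0 : ∀ S, 0 ≤ G S) :
    0 ≤ mixedFormW p ends s X X F G ((connEvent ends s v).indicator 1) (fun _ => 1) := by
  have hw₁ : ∀ ω, 0 ≤ (connEvent ends s v).indicator (1 : Config E → R) ω :=
    fun ω => Set.indicator_apply_nonneg fun _ => zero_le_one
  have hw₀ : ∀ ω, 0 ≤ ((connEvent ends s v)ᶜ).indicator (1 : Config E → R) ω :=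
    fun ω => Set.indicator_apply_nonneg fun _ => zero_le_one
  have hπ0 : 0 ≤ wExpect p ends s X (fun _ => 1) ((connEvent ends s v).indicator 1) := by
    unfold wExpect
    exact expect_nonneg hp fun ω => mul_nonneg (mul_nonneg zero_le_one (hw₁ ω))
      (Set.indicator_apply_nonneg fun _ => zero_le_one)
  have hπ'0 : 0 ≤ wExpect p ends s X (fun _ => 1) (((connEvent ends s v)ᶜ).indicator 1) := by
    unfold wExpect
    exact expect_nonneg hp fun ω => mul_nonneg (mul_nonneg zero_le_one (hw₀ ω))
      (Set.indicator_apply_nonneg fun _ => zero_le_one)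
  rcases hπ0.lt_or_eq with hπ | hπ
  · rcases hπ'0.lt_or_eq with hπ' | hπ'
    · have := mixedForm_one_nonneg_of_s2Form p hp ends s v X X hF hG hF0 hG0
        (by rwa [Finset.union_self]) (by rwa [Finset.union_self])
        (hS2 p hp X v F G hF hG hF0 hG0)
      exact this
    · -- `π' = 0`: the `v̄`-class is void and `M = 2·S_1 ≥ 0`
      have hz := hπ'.symm
      have hx' := wExpect_eq_zero_of_mass_zero hp ends s X (fun W => F W * G W) hw₀ hz
      have ha' := wExpect_eq_zero_of_mass_zero hp ends s X F hw₀ hz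
      have hc' := wExpect_eq_zero_of_mass_zero hp ends s X G hw₀ hz
      have hB := bhkForm_one_nonneg p hp ends s X X hF hG hF0 hG0
      unfold bhkFormW at hB
      rw [Finset.inter_self, Finset.union_self, wExpect_one_split p ends s v X (fun W => F W * G W),
        wExpect_one_split p ends s v X (fun _ => 1), wExpect_one_split p ends s v X F,
        wExpect_one_split p ends s v X G, hx', ha', hc', hz] at hB
      rw [mixedForm_one_diag_eq, hx', ha', hc', hz]
      nlinarith [hB]
  · -- `π = 0`: the `v`-class is void and `M = 0`
    have hz := hπ.symm
    have hx := wExpect_eq_zero_of_mass_zero hp ends s X (fun W => F W * G W) hw₁ hz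
    have ha := wExpect_eq_zero_of_mass_zero hp ends s X F hw₁ hz
    have hc := wExpect_eq_zero_of_mass_zero hp ends s X G hw₁ hz
    rw [mixedForm_one_diag_eq, hx, ha, hc, hz]
    ring_nf
    exact le_refl 0

end PointSplit

end CovForm

end Summit.Ventures.PercRepro2
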